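import Literature.Probability.Percolation.TwoClusterConditionalAssociationProofs
import Literature.Probability.Percolation.OpenGraphCuts
import Mathlib.Tactic.Linarith
import HarnessLib

/-!
# Cluster repulsion and the hypothesis-free product form for the pocket cells of `Z(3,2)`

Support file for stmt-CriticalPhenomena-4575 (`NoHeavyLowerTail`; crux CLOSED by p205010) on the insurance line
`Z(3,2)` = `OneCutFive.ZeroOneThree` (`Σ_v μ(o↔v) > 2 ⟹ μ(B={a}) ≤ μ(B={b,c})` at the weakest target `a`, where
`B ⊆ {a,b,c}` is the set of targets joined to the observer `o`).  Prover seat `prim-ineq-gen-8` (gen 10).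
No `sorry`, standard axioms, no definitions.  Companion file `…OneCutFiveHeavyHair.lean` turns these into the
pocket exchange at a general observer with one hair of weight `≥ ½`.

WHAT IS PROVED (arbitrary finite vertex type `V`, `μ = prodBernoulli w`):
* `condConn_posCorrelation` / `condConn_negCorrelation` — van den Berg–Häggström–Kahn 2006, Thm. 1.3/1.5 and
  eq. (2), as measure inequalities for connection events, from the tree's PROVED fact
  `BHK2006_twoClusterConditionalAssociation_holds`.
* `clusterRepulsion` (new) — `μ(o↔a,o↮c,b↔c)·μ(o↔c,o↮a,b↮c) ≤ μ(o↔a,o↮c,b↮c)·μ(o↔c,o↮a,b↔c)`, i.e.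
  `P(b↔c | o↔c, o↮a) ≥ P(b↔c | o↔a, o↮c)`: on `D = {c ↮ a}` the four cells are `D`-events in `{c↔b}`, `{c↔o}`
  (increasing in `C_c`) and `{a↔o}` (increasing in `C_a`); eq. (2) and Thm. 1.5 give two product inequalities
  whose product is the claim.
* `productForm_star` (new) — `μ(B={a})·μ(B={c}) ≤ μ(o↔a,o↮c,b↮c)·μ(o↔c,o↮a,b↮a)`, from `clusterRepulsion` at
  `(a,c)` and `(c,a)` combined multiplicatively.
NEAREST PRINT: van den Berg–Häggström–Kahn, Random Struct. Alg. 29 (2006), Thms 1.3–1.5 and eq. (2)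
(sign-only conditional association; the four-point exchange consequences are ours).  Numerics (seat folder
lab10/): 0 violations / 6·10⁴ random weighted graphs `n ≤ 8`; equality on every 4-cycle `o–a–b–c–o` and on the
families where `b` hangs off `c`'s side only.
-/

noncomputable section

namespace Summit.CriticalPhenomena.PercolationContinuityZ3.Theorems

open MeasureTheory Set Literature.Probability.LatticeModels Literature.Probability.Percolation
open scoped Classical BigOperators

namespace OneCutFive

variable {V : Type*} [Fintype V]

/-- **Conditional positive correlation of two connections from `s` given `{s ↮ t}`** (van den
Berg–Häggström–Kahn 2006, Thm. 1.3/1.5 with `f = 1{s ↔ a}`, `g = 1{s ↔ b}`):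
`μ(D ∩ {s↔a}) μ(D ∩ {s↔b}) ≤ μ(D) μ(D ∩ {s↔a} ∩ {s↔b})`, `D = {s ↮ t}`.
[cite: VandenbergHaggstromKahn2005, Thm. 1.5 (p. 7)] -/
theorem condConn_posCorrelation (w : Sym2 V → unitInterval) (s t a b : V) (hst : s ≠ t) :
    (prodBernoulli w).real ((openConn s t)ᶜ ∩ openConn s a) *
        (prodBernoulli w).real ((openConn s t)ᶜ ∩ openConn s b) ≤
      (prodBernoulli w).real (openConn s t)ᶜ *
        (prodBernoulli w).real ((openConn s t)ᶜ ∩ (openConn s a ∩ openConn s b)) := by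
  have key := BHK2006_twoClusterConditionalAssociation_holds V w s t
    (fun C _ => connIndicatorFn s a C) (fun C _ => connIndicatorFn s b C)
    (fun _ => monotone_connIndicatorFn s a) (fun _ => antitone_const)
    (fun _ => monotone_connIndicatorFn s b) (fun _ => antitone_const) hst
  have hD : {ω : BondConfig V | ¬ (openGraph ω).Reachable s t} = (openConn s t)ᶜ := rfl
  have hma : MeasurableSet (openConn s a : Set (BondConfig V)) := measurableSet_openConn_holds s a
  have hmb : MeasurableSet (openConn s b : Set (BondConfig V)) := measurableSet_openConn_holds s b
  simp only [connIndicatorFn_openEdgeCluster, hD] at key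
  rw [show (fun ω : BondConfig V => (openConn s a).indicator (1 : BondConfig V → ℝ) ω *
        (openConn s b).indicator 1 ω) = (openConn s a ∩ openConn s b).indicator 1 from
      funext fun ω => (congrFun (Set.inter_indicator_one (s := openConn s a)
        (t := openConn s b) (M₀ := ℝ)) ω).symm] at key
  rw [setIntegral_indicator (hma.inter hmb), setIntegral_indicator hma, setIntegral_indicator hmb]
    at key
  simpa only [Pi.one_apply, setIntegral_const, smul_eq_mul, mul_one] using key


/-- **Conditional negative correlation** (van den Berg–Häggström–Kahn 2006, eq. (2)), re-exported from the tree's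
proved fact: `μ(D) μ(D ∩ {s↔a} ∩ {t↔b}) ≤ μ(D ∩ {s↔a}) μ(D ∩ {t↔b})`, `D = {s ↮ t}`.
[cite: VandenbergHaggstromKahn2005, eq. (2) (p. 2), Thm. 1.4 (p. 7)] -/
theorem condConn_negCorrelation (w : Sym2 V → unitInterval) (s t a b : V) (hst : s ≠ t) :
    (prodBernoulli w).real (openConn s t)ᶜ *
        (prodBernoulli w).real ((openConn s t)ᶜ ∩ (openConn s a ∩ openConn t b)) ≤
      (prodBernoulli w).real ((openConn s t)ᶜ ∩ openConn s a) *
        (prodBernoulli w).real ((openConn s t)ᶜ ∩ openConn t b) :=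
  BHK2006_twoClusterConditionalAssociation.openConn_negCorrelation
    BHK2006_twoClusterConditionalAssociation_holds V w s t a b hst

/-- **CLUSTER REPULSION** (the key lemma; new).  For every finite weighted graph and vertices `o, a, b, c`
with `c ≠ a`:
`μ(o↔a, o↮c, b↔c) · μ(o↔c, o↮a, b↮c) ≤ μ(o↔a, o↮c, b↮c) · μ(o↔c, o↮a, b↔c)`,
i.e. `P(b↔c | o↔c, o↮a) ≥ P(b↔c | o↔a, o↮c)`: the cluster of `c` is MORE likely to contain `b` when it
contains the observer `o` (and avoids `a`) than when it must avoid the observer's cluster (which contains `a`).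
Proof: on `D = {c ↮ a}` the four events are `D ∩ {c↔b} ∩ {a↔o}`, `D ∩ {c↔o} ∖ {c↔b}`, `D ∩ {a↔o} ∖ {c↔b}`,
`D ∩ {c↔o} ∩ {c↔b}`; BHK (2006) eq. (2) gives `μ(D) μ(D,c↔b,a↔o) ≤ μ(D,c↔b) μ(D,a↔o)` and Thm. 1.3/1.5 gives
`μ(D,c↔o) μ(D,c↔b) ≤ μ(D) μ(D,c↔o,c↔b)`; multiply. [this work; cite: VandenbergHaggstromKahn2005, Thm. 1.5 (p. 7), eq. (2) (p. 2)] -/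
theorem clusterRepulsion (w : Sym2 V → unitInterval) (o a b c : V) (hca : c ≠ a) :
    (prodBernoulli w).real {ω | ω ∈ openConn o a ∧ ω ∉ openConn o c ∧ ω ∈ openConn b c} *
        (prodBernoulli w).real {ω | ω ∈ openConn o c ∧ ω ∉ openConn o a ∧ ω ∉ openConn b c} ≤
      (prodBernoulli w).real {ω | ω ∈ openConn o a ∧ ω ∉ openConn o c ∧ ω ∉ openConn b c} *
        (prodBernoulli w).real {ω | ω ∈ openConn o c ∧ ω ∉ openConn o a ∧ ω ∈ openConn b c} := by
  set μ := prodBernoulli w with hμ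
  have hmeas : ∀ S : Set (BondConfig V), MeasurableSet S := fun _ => MeasurableSet.of_discrete
  set D : Set (BondConfig V) := (openConn c a)ᶜ with hDdef
  set β : Set (BondConfig V) := openConn c b with hβdef
  set J : Set (BondConfig V) := openConn a o with hJdef
  set θ : Set (BondConfig V) := openConn c o with hθdef
  -- the four cells as `D`-events
  have ex : {ω : BondConfig V | ω ∈ openConn o a ∧ ω ∉ openConn o c ∧ ω ∈ openConn b c} = D ∩ (β ∩ J) := by
    ext ω
    simp only [mem_setOf_eq, mem_inter_iff, mem_compl_iff, hDdef, hβdef, hJdef, mem_openConn_iff_reachable]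
    constructor
    · rintro ⟨hoa, hoc, hbc⟩
      exact ⟨fun hca' => hoc (hoa.trans hca'.symm), hbc.symm, hoa.symm⟩
    · rintro ⟨hca', hcb, hao⟩
      exact ⟨hao.symm, fun hoc => hca' (hoc.symm.trans hao.symm), hcb.symm⟩
  have ey : {ω : BondConfig V | ω ∈ openConn o a ∧ ω ∉ openConn o c ∧ ω ∉ openConn b c} = (D ∩ J) \ β := by
    ext ω
    simp only [mem_setOf_eq, mem_inter_iff, mem_compl_iff, mem_sdiff, hDdef, hβdef, hJdef, mem_openConn_iff_reachable]
    constructor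
    · rintro ⟨hoa, hoc, hbc⟩
      exact ⟨⟨fun hca' => hoc (hoa.trans hca'.symm), hoa.symm⟩, fun hcb => hbc hcb.symm⟩
    · rintro ⟨⟨hca', hao⟩, hcb⟩
      exact ⟨hao.symm, fun hoc => hca' (hoc.symm.trans hao.symm), fun hbc => hcb hbc.symm⟩
  have eq_ : {ω : BondConfig V | ω ∈ openConn o c ∧ ω ∉ openConn o a ∧ ω ∉ openConn b c} = (D ∩ θ) \ β := by
    ext ω
    simp only [mem_setOf_eq, mem_inter_iff, mem_compl_iff, mem_sdiff, hDdef, hβdef, hθdef, mem_openConn_iff_reachable]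
    constructor
    · rintro ⟨hoc, hoa, hbc⟩
      exact ⟨⟨fun hca' => hoa (hoc.trans hca'), hoc.symm⟩, fun hcb => hbc hcb.symm⟩
    · rintro ⟨⟨hca', hco⟩, hcb⟩
      exact ⟨hco.symm, fun hoa => hca' (hco.trans hoa), fun hbc => hcb hbc.symm⟩
  have ep : {ω : BondConfig V | ω ∈ openConn o c ∧ ω ∉ openConn o a ∧ ω ∈ openConn b c} = D ∩ (θ ∩ β) := by
    ext ω
    simp only [mem_setOf_eq, mem_inter_iff, mem_compl_iff, hDdef, hβdef, hθdef, mem_openConn_iff_reachable]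
    constructor
    · rintro ⟨hoc, hoa, hbc⟩
      exact ⟨fun hca' => hoa (hoc.trans hca'), hoc.symm, hbc.symm⟩
    · rintro ⟨hca', hco, hcb⟩
      exact ⟨hco.symm, fun hoa => hca' (hco.trans hoa), hcb.symm⟩
  rw [ex, ey, eq_, ep]
  -- the two BHK inputs
  have h1 : μ.real D * μ.real (D ∩ (β ∩ J)) ≤ μ.real (D ∩ β) * μ.real (D ∩ J) :=
    condConn_negCorrelation w c a b o hca
  have h2 : μ.real (D ∩ θ) * μ.real (D ∩ β) ≤ μ.real D * μ.real (D ∩ (θ ∩ β)) :=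
    condConn_posCorrelation w c a o b hca
  -- bookkeeping
  have hy : μ.real ((D ∩ J) \ β) = μ.real (D ∩ J) - μ.real (D ∩ (β ∩ J)) := by
    have h := measureReal_inter_add_sdiff (μ := μ) (s := D ∩ J) (hmeas β)
    rw [show (D ∩ J) ∩ β = D ∩ (β ∩ J) from by ext ω; simp only [mem_inter_iff]; tauto] at h
    linarith
  have hq : μ.real ((D ∩ θ) \ β) = μ.real (D ∩ θ) - μ.real (D ∩ (θ ∩ β)) := by
    have h := measureReal_inter_add_sdiff (μ := μ) (s := D ∩ θ) (hmeas β)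
    rw [show (D ∩ θ) ∩ β = D ∩ (θ ∩ β) from by ext ω; simp only [mem_inter_iff]; tauto] at h
    linarith
  rw [hy, hq]
  have hxm : μ.real (D ∩ (β ∩ J)) ≤ μ.real D := measureReal_mono inter_subset_left
  have hx0 : 0 ≤ μ.real (D ∩ (β ∩ J)) := measureReal_nonneg
  have hj0 : 0 ≤ μ.real (D ∩ J) := measureReal_nonneg
  have hT0 : 0 ≤ μ.real (D ∩ θ) := measureReal_nonneg
  have hp0 : 0 ≤ μ.real (D ∩ (θ ∩ β)) := measureReal_nonneg
  have hn0 : 0 ≤ μ.real (D ∩ β) := measureReal_nonneg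
  have hm0 : 0 ≤ μ.real D := measureReal_nonneg
  by_cases hm : μ.real D = 0
  · have hx : μ.real (D ∩ (β ∩ J)) = 0 := le_antisymm (hm ▸ hxm) hx0
    rw [hx]
    nlinarith [measureReal_mono (μ := μ) (show D ∩ (β ∩ J) ⊆ D ∩ J from fun ω h => ⟨h.1, h.2.2⟩)]
  · have hm' : 0 < μ.real D := lt_of_le_of_ne hm0 (Ne.symm hm)
    have h3 : μ.real D * (μ.real (D ∩ (β ∩ J)) * μ.real (D ∩ θ)) ≤
        μ.real D * (μ.real (D ∩ J) * μ.real (D ∩ (θ ∩ β))) := by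
      nlinarith [mul_le_mul_of_nonneg_right h1 hT0, mul_le_mul_of_nonneg_left h2 hj0]
    have h4 : μ.real (D ∩ (β ∩ J)) * μ.real (D ∩ θ) ≤ μ.real (D ∩ J) * μ.real (D ∩ (θ ∩ β)) :=
      le_of_mul_le_mul_left h3 hm'
    nlinarith


/-- **PRODUCT FORM (hypothesis-free)** (new).  For every finite weighted graph and `o, a, b, c` with `a ≠ c`:
`μ(o↔a only) · μ(o↔c only) ≤ μ(o↔a, o↮c, b↮c) · μ(o↔c, o↮a, b↮a)`
where "`o↔a` only" is the pocket event `{o↔a, o↮b, o↮c}` (`B = {a}`).  From `clusterRepulsion` at `(a,c)` and at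
`(c,a)`: `P(b↮c | A₁) ≥ P(b↮c | A₂)` and `P(b↮a | A₁) ≤ P(b↮a | A₂)` with `A₁ = {o↔a, o↮c}`, `A₂ = {o↔c, o↮a}`;
divide. [this work] -/
theorem productForm_star (w : Sym2 V → unitInterval) (o a b c : V) (hac : a ≠ c) :
    (prodBernoulli w).real {ω | ω ∈ openConn o a ∧ ω ∉ openConn o b ∧ ω ∉ openConn o c} *
        (prodBernoulli w).real {ω | ω ∈ openConn o c ∧ ω ∉ openConn o a ∧ ω ∉ openConn o b} ≤
      (prodBernoulli w).real {ω | ω ∈ openConn o a ∧ ω ∉ openConn o c ∧ ω ∉ openConn b c} *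
        (prodBernoulli w).real {ω | ω ∈ openConn o c ∧ ω ∉ openConn o a ∧ ω ∉ openConn b a} := by
  set μ := prodBernoulli w with hμ
  have hmeas : ∀ S : Set (BondConfig V), MeasurableSet S := fun _ => MeasurableSet.of_discrete
  -- literals
  set P : Set (BondConfig V) := {ω | ω ∈ openConn o a ∧ ω ∉ openConn o c} with hPdef
  set Q : Set (BondConfig V) := {ω | ω ∈ openConn o c ∧ ω ∉ openConn o a} with hQdef
  set L : Set (BondConfig V) := openConn b c with hLdef
  set L' : Set (BondConfig V) := openConn b a with hL'def
  -- the two repulsion inequalities, in `P/Q/L` form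
  have rep1 := clusterRepulsion w o a b c hac.symm
  have rep2 := clusterRepulsion w o c b a hac
  have e1 : {ω : BondConfig V | ω ∈ openConn o a ∧ ω ∉ openConn o c ∧ ω ∈ openConn b c} = P ∩ L := by
    ext ω; simp only [mem_setOf_eq, mem_inter_iff, hPdef, hLdef]; tauto
  have e2 : {ω : BondConfig V | ω ∈ openConn o c ∧ ω ∉ openConn o a ∧ ω ∉ openConn b c} = Q \ L := by
    ext ω; simp only [mem_setOf_eq, mem_sdiff, hQdef, hLdef]; tauto
  have e3 : {ω : BondConfig V | ω ∈ openConn o a ∧ ω ∉ openConn o c ∧ ω ∉ openConn b c} = P \ L := by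
    ext ω; simp only [mem_setOf_eq, mem_sdiff, hPdef, hLdef]; tauto
  have e4 : {ω : BondConfig V | ω ∈ openConn o c ∧ ω ∉ openConn o a ∧ ω ∈ openConn b c} = Q ∩ L := by
    ext ω; simp only [mem_setOf_eq, mem_inter_iff, hQdef, hLdef]; tauto
  have f1 : {ω : BondConfig V | ω ∈ openConn o c ∧ ω ∉ openConn o a ∧ ω ∈ openConn b a} = Q ∩ L' := by
    ext ω; simp only [mem_setOf_eq, mem_inter_iff, hQdef, hL'def]; tauto
  have f2 : {ω : BondConfig V | ω ∈ openConn o a ∧ ω ∉ openConn o c ∧ ω ∉ openConn b a} = P \ L' := by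
    ext ω; simp only [mem_setOf_eq, mem_sdiff, hPdef, hL'def]; tauto
  have f3 : {ω : BondConfig V | ω ∈ openConn o c ∧ ω ∉ openConn o a ∧ ω ∉ openConn b a} = Q \ L' := by
    ext ω; simp only [mem_setOf_eq, mem_sdiff, hQdef, hL'def]; tauto
  have f4 : {ω : BondConfig V | ω ∈ openConn o a ∧ ω ∉ openConn o c ∧ ω ∈ openConn b a} = P ∩ L' := by
    ext ω; simp only [mem_setOf_eq, mem_inter_iff, hPdef, hL'def]; tauto
  rw [e1, e2, e3, e4] at rep1
  rw [f1, f2, f3, f4] at rep2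
  -- the pocket cells: `{o↔a, o↮b, o↮c} = P ∖ L'`, `{o↔c, o↮a, o↮b} = Q ∖ L`
  have g1 : {ω : BondConfig V | ω ∈ openConn o a ∧ ω ∉ openConn o b ∧ ω ∉ openConn o c} = P \ L' := by
    ext ω
    simp only [mem_setOf_eq, mem_sdiff, hPdef, hL'def, mem_openConn_iff_reachable]
    constructor
    · rintro ⟨hoa, hob, hoc⟩
      exact ⟨⟨hoa, hoc⟩, fun hba => hob (hoa.trans hba.symm)⟩
    · rintro ⟨⟨hoa, hoc⟩, hba⟩
      exact ⟨hoa, fun hob => hba (hob.symm.trans hoa), hoc⟩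
  have g2 : {ω : BondConfig V | ω ∈ openConn o c ∧ ω ∉ openConn o a ∧ ω ∉ openConn o b} = Q \ L := by
    ext ω
    simp only [mem_setOf_eq, mem_sdiff, hQdef, hLdef, mem_openConn_iff_reachable]
    constructor
    · rintro ⟨hoc, hoa, hob⟩
      exact ⟨⟨hoc, hoa⟩, fun hbc => hob (hoc.trans hbc.symm)⟩
    · rintro ⟨⟨hoc, hoa⟩, hbc⟩
      exact ⟨hoc, hoa, fun hob => hbc (hob.symm.trans hoc)⟩
  rw [g1, g2, e3, f3]
  -- masses
  have hPL : μ.real (P ∩ L) + μ.real (P \ L) = μ.real P := measureReal_inter_add_sdiff (hmeas L)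
  have hQL : μ.real (Q ∩ L) + μ.real (Q \ L) = μ.real Q := measureReal_inter_add_sdiff (hmeas L)
  have hPL' : μ.real (P ∩ L') + μ.real (P \ L') = μ.real P := measureReal_inter_add_sdiff (hmeas L')
  have hQL' : μ.real (Q ∩ L') + μ.real (Q \ L') = μ.real Q := measureReal_inter_add_sdiff (hmeas L')
  have n1 : 0 ≤ μ.real (P ∩ L) := measureReal_nonneg
  have n2 : 0 ≤ μ.real (P \ L) := measureReal_nonneg
  have n3 : 0 ≤ μ.real (Q ∩ L) := measureReal_nonneg
  have n4 : 0 ≤ μ.real (Q \ L) := measureReal_nonneg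
  have n5 : 0 ≤ μ.real (P ∩ L') := measureReal_nonneg
  have n6 : 0 ≤ μ.real (P \ L') := measureReal_nonneg
  have n7 : 0 ≤ μ.real (Q ∩ L') := measureReal_nonneg
  have n8 : 0 ≤ μ.real (Q \ L') := measureReal_nonneg
  -- rep1 ⇒ μ(P∖L)·μ(Q) ≥ μ(P)·μ(Q∖L);  rep2 ⇒ μ(Q∖L')·μ(P) ≥ μ(Q)·μ(P∖L')
  have r1 : μ.real P * μ.real (Q \ L) ≤ μ.real (P \ L) * μ.real Q := by nlinarith
  have r2 : μ.real Q * μ.real (P \ L') ≤ μ.real (Q \ L') * μ.real P := by nlinarith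
  by_cases hP : μ.real P = 0
  · have : μ.real (P \ L') = 0 := le_antisymm (by rw [← hP]; exact measureReal_mono sdiff_subset) n6
    rw [this, zero_mul]; exact mul_nonneg n2 n8
  by_cases hQ : μ.real Q = 0
  · have : μ.real (Q \ L) = 0 := le_antisymm (by rw [← hQ]; exact measureReal_mono sdiff_subset) n4
    rw [this, mul_zero]; exact mul_nonneg n2 n8
  have hP' : 0 < μ.real P := lt_of_le_of_ne measureReal_nonneg (Ne.symm hP)
  have hQ' : 0 < μ.real Q := lt_of_le_of_ne measureReal_nonneg (Ne.symm hQ)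
  -- multiply r1 and r2 and cancel μ(P) μ(Q) > 0
  have key : (μ.real P * μ.real Q) * (μ.real (P \ L') * μ.real (Q \ L)) ≤
      (μ.real P * μ.real Q) * (μ.real (P \ L) * μ.real (Q \ L')) := by
    have := mul_le_mul r1 r2 (mul_nonneg measureReal_nonneg n6) (mul_nonneg n2 measureReal_nonneg)
    nlinarith
  exact le_of_mul_le_mul_left key (mul_pos hP' hQ')


/-- **CROSSING INEQUALITY** (new; tight on every 4-cycle `o–a–b–c–o`).  For every finite weighted graph and
`o, a, b, c` with `c ≠ a`:  `μ(oa|bc) · μ(oc|ab) ≤ μ(oab|c) · μ(obc|a)`, written with the literals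
`P = {o↔a, o↮c}`, `Q = {o↔c, o↮a}`:  `μ(P, b↔c) · μ(Q, b↔a) ≤ μ(P, b↔a) · μ(Q, b↔c)` — the two "crossing
two-pair splits" are jointly dominated by the two `o`-centred triples.  Proof: on `D = {c ↮ a}` the four cells are
`D∩{c↔b}∩{a↔o}`, `D∩{c↔o}∩{a↔b}`, `D∩{a↔o}∩{a↔b}`, `D∩{c↔o}∩{c↔b}`; van den Berg–Häggström–Kahn eq. (2) twice
(`C_c` vs `C_a`, negative) and Thm 1.3 twice (within `C_c`, within `C_a`, positive), multiplied.
[this work; cite: VandenbergHaggstromKahn2005, Thm. 1.5 (p. 7), eq. (2) (p. 2)] -/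
theorem crossingInequality (w : Sym2 V → unitInterval) (o a b c : V) (hca : c ≠ a) :
    (prodBernoulli w).real {ω | ω ∈ openConn o a ∧ ω ∉ openConn o c ∧ ω ∈ openConn b c} *
        (prodBernoulli w).real {ω | ω ∈ openConn o c ∧ ω ∉ openConn o a ∧ ω ∈ openConn b a} ≤
      (prodBernoulli w).real {ω | ω ∈ openConn o a ∧ ω ∉ openConn o c ∧ ω ∈ openConn b a} *
        (prodBernoulli w).real {ω | ω ∈ openConn o c ∧ ω ∉ openConn o a ∧ ω ∈ openConn b c} := by
  set μ := prodBernoulli w with hμ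
  set D : Set (BondConfig V) := (openConn c a)ᶜ with hDdef
  set β : Set (BondConfig V) := openConn c b with hβdef
  set J : Set (BondConfig V) := openConn a o with hJdef
  set θ : Set (BondConfig V) := openConn c o with hθdef
  set K : Set (BondConfig V) := openConn a b with hKdef
  have ex : {ω : BondConfig V | ω ∈ openConn o a ∧ ω ∉ openConn o c ∧ ω ∈ openConn b c} = D ∩ (β ∩ J) := by
    ext ω
    simp only [mem_setOf_eq, mem_inter_iff, mem_compl_iff, hDdef, hβdef, hJdef, mem_openConn_iff_reachable]
    constructor
    · rintro ⟨hoa, hoc, hbc⟩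
      exact ⟨fun hca' => hoc (hoa.trans hca'.symm), hbc.symm, hoa.symm⟩
    · rintro ⟨hca', hcb, hao⟩
      exact ⟨hao.symm, fun hoc => hca' (hoc.symm.trans hao.symm), hcb.symm⟩
  have ey : {ω : BondConfig V | ω ∈ openConn o c ∧ ω ∉ openConn o a ∧ ω ∈ openConn b a} = D ∩ (θ ∩ K) := by
    ext ω
    simp only [mem_setOf_eq, mem_inter_iff, mem_compl_iff, hDdef, hθdef, hKdef, mem_openConn_iff_reachable]
    constructor
    · rintro ⟨hoc, hoa, hba⟩
      exact ⟨fun hca' => hoa (hoc.trans hca'), hoc.symm, hba.symm⟩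
    · rintro ⟨hca', hco, hab⟩
      exact ⟨hco.symm, fun hoa => hca' (hco.trans hoa), hab.symm⟩
  have er : {ω : BondConfig V | ω ∈ openConn o a ∧ ω ∉ openConn o c ∧ ω ∈ openConn b a} = D ∩ (J ∩ K) := by
    ext ω
    simp only [mem_setOf_eq, mem_inter_iff, mem_compl_iff, hDdef, hJdef, hKdef, mem_openConn_iff_reachable]
    constructor
    · rintro ⟨hoa, hoc, hba⟩
      exact ⟨fun hca' => hoc (hoa.trans hca'.symm), hoa.symm, hba.symm⟩
    · rintro ⟨hca', hao, hab⟩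
      exact ⟨hao.symm, fun hoc => hca' (hoc.symm.trans hao.symm), hab.symm⟩
  have ep : {ω : BondConfig V | ω ∈ openConn o c ∧ ω ∉ openConn o a ∧ ω ∈ openConn b c} = D ∩ (θ ∩ β) := by
    ext ω
    simp only [mem_setOf_eq, mem_inter_iff, mem_compl_iff, hDdef, hβdef, hθdef, mem_openConn_iff_reachable]
    constructor
    · rintro ⟨hoc, hoa, hbc⟩
      exact ⟨fun hca' => hoa (hoc.trans hca'), hoc.symm, hbc.symm⟩
    · rintro ⟨hca', hco, hcb⟩
      exact ⟨hco.symm, fun hoa => hca' (hco.trans hoa), hcb.symm⟩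
  rw [ex, ey, er, ep]
  -- four BHK inputs
  have n1 : μ.real D * μ.real (D ∩ (β ∩ J)) ≤ μ.real (D ∩ β) * μ.real (D ∩ J) :=
    condConn_negCorrelation w c a b o hca
  have n2 : μ.real D * μ.real (D ∩ (θ ∩ K)) ≤ μ.real (D ∩ θ) * μ.real (D ∩ K) :=
    condConn_negCorrelation w c a o b hca
  have p1 : μ.real (D ∩ θ) * μ.real (D ∩ β) ≤ μ.real D * μ.real (D ∩ (θ ∩ β)) :=
    condConn_posCorrelation w c a o b hca
  have p2 : μ.real (D ∩ J) * μ.real (D ∩ K) ≤ μ.real D * μ.real (D ∩ (J ∩ K)) := by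
    have h := condConn_posCorrelation w a c o b hca.symm
    have hsym : (openConn a c : Set (BondConfig V)) = openConn c a := by
      ext ω; exact ⟨fun h => SimpleGraph.Reachable.symm h, fun h => SimpleGraph.Reachable.symm h⟩
    rw [hsym] at h
    exact h
  have hm0 : 0 ≤ μ.real D := measureReal_nonneg
  have hx0 : 0 ≤ μ.real (D ∩ (β ∩ J)) := measureReal_nonneg
  have hy0 : 0 ≤ μ.real (D ∩ (θ ∩ K)) := measureReal_nonneg
  have hr0 : 0 ≤ μ.real (D ∩ (J ∩ K)) := measureReal_nonneg
  have hp0 : 0 ≤ μ.real (D ∩ (θ ∩ β)) := measureReal_nonneg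
  have hβ0 : 0 ≤ μ.real (D ∩ β) := measureReal_nonneg
  have hJ0 : 0 ≤ μ.real (D ∩ J) := measureReal_nonneg
  have hθ0 : 0 ≤ μ.real (D ∩ θ) := measureReal_nonneg
  have hK0 : 0 ≤ μ.real (D ∩ K) := measureReal_nonneg
  by_cases hm : μ.real D = 0
  · have hx : μ.real (D ∩ (β ∩ J)) = 0 :=
      le_antisymm (hm ▸ measureReal_mono inter_subset_left) hx0
    rw [hx, zero_mul]; exact mul_nonneg hr0 hp0
  · have hm' : 0 < μ.real D := lt_of_le_of_ne hm0 (Ne.symm hm)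
    -- m² x y ≤ (nβ nJ)(nθ nK) ≤ (m p)(m r)
    have h3 : (μ.real D * μ.real D) * (μ.real (D ∩ (β ∩ J)) * μ.real (D ∩ (θ ∩ K))) ≤
        (μ.real D * μ.real D) * (μ.real (D ∩ (J ∩ K)) * μ.real (D ∩ (θ ∩ β))) := by
      have h12 := mul_le_mul n1 n2 (mul_nonneg hm0 hy0) (mul_nonneg hβ0 hJ0)
      have h34 := mul_le_mul p1 p2 (mul_nonneg hJ0 hK0) (mul_nonneg hm0 hp0)
      nlinarith
    exact le_of_mul_le_mul_left h3 (mul_pos hm' hm')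

end OneCutFive

end Summit.CriticalPhenomena.PercolationContinuityZ3.Theorems

end
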